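import Summits.HubbardSuperconductivity.HubbardLadder.Bounds.CouplingPolymerGas
import HarnessLib

/-!
# Kotecký–Preiss smallness of the site activities of a bond-dependent coupling (pub-hubbard
# BOUNDS, Theorem 12 — Lemmas 12.3–12.4 in the tree's Cauchy form, generic part; KERNEL-PROVED
# support)

HONEST FRAMING: ladder R1–R4 with certified numbers; no claim on H/H₀; bounds for model classes, no
materials claim.

Cell `pub-hubbard`, LEAN FILING REQUEST #181 PART #181.5a (bounds g23; split off #181.5 for
`lint.size` by bounds g25, declarations byte-identical): `sum_norm_siteActivityC_mul_exp_le` — on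
the bonds of a graph of maximal degree `Δ`, with `λ = e⁶ r₀² s`, `|c_b| ≤ s ≤ 1`, `(8Δ+1)² λ ≤ 1/2`:
`Σ_{A ∋ x} |siteActivityC (bonds G) β U μ c A| e^{2|A|} ≤ 8Δλ` (the tree's
`sum_norm_siteActivity_mul_exp_le` ported to bond-dependent couplings). The `t–t'` bond graph of the
torus, its degree and the claim node are in `Bounds/TwistedActivitySmallness.lean` (#181.5), which
imports this file; it needs only `Bounds/CouplingPolymerGas.lean` (#181.4a).

References: Ueltschi, arXiv:cond-mat/9810320 §3; Kotecký–Preiss, CMP 103 (1986) 491, Thm. 1.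
-/

namespace Summit.HubbardSuperconductivity.HubbardLadder.Bounds

open Matrix Finset Literature.MathematicalPhysics.QuantumLattice
  Literature.Probability.LatticeModels
  Literature.Analysis.Complex.FiniteDifference
open scoped ComplexConjugate

noncomputable section

/-! ### Kotecký–Preiss smallness of the site activities for bond-dependent couplings -/

section Smallness

variable {Λ : Type*} [LinearOrder Λ] [Fintype Λ] {β U μ : ℂ}
variable {G : SimpleGraph Λ} [DecidableRel G.Adj] {Δ : ℕ}

/-- **One-site Kotecký–Preiss smallness of the site activity for a bond-dependent coupling** on
the bonds of a graph of maximal degree `Δ` (the tree's `sum_norm_siteActivity_mul_exp_le` ported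
verbatim, `‖τ‖ ↦ s`): with `λ = e⁶ r₀² s`, if `r ≤ r₀`, `1 ≤ r₀`, `|c_b| ≤ s ≤ 1` and
`(8Δ+1)² λ ≤ 1/2`, then for every site `x` and every finite family `𝒜` of site sets containing `x`,
`Σ_{A ∈ 𝒜} |siteActivityC (bonds G) c A| e^{2|A|} ≤ 8Δλ` — bounds.tex Lemmas 12.3–12.4 in the
tree's (Cauchy) form. [cite: Ueltschi1999, §3 (|ρ(𝒜)| ≤ e^{-c|𝒜|} if 2χ e^{c+1} βt ≤ 1); KoteckyPreiss1986, Thm. 1 (the criterion this feeds)] -/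
theorem sum_norm_siteActivityC_mul_exp_le (hΔ : ∀ v : Λ, (Finset.univ.filter (G.Adj v)).card ≤ Δ)
    (hz : atomicPartitionFn β U μ ≠ 0) {r₀ : ℝ} (hr₀ : 1 ≤ r₀) (hr : siteRatio β U μ ≤ r₀)
    {s : ℝ} (hs0 : 0 ≤ s) (hs1 : s ≤ 1) {c : Bond Λ → ℂ} (hc : ∀ b, ‖c b‖ ≤ s)
    (hsmall : ((8 * Δ : ℕ) + 1 : ℝ) ^ 2 * (Real.exp 6 * r₀ ^ 2 * s) ≤ 1 / 2)
    (x : Λ) (𝒜 : Finset (Finset Λ)) (h𝒜 : ∀ A ∈ 𝒜, x ∈ A) :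
    ∑ A ∈ 𝒜, ‖siteActivityC (hubbardBonds G) β U μ c A‖ * Real.exp (2 * A.card) ≤
      8 * Δ * (Real.exp 6 * r₀ ^ 2 * s) := by
  classical
  set lam : ℝ := Real.exp 6 * r₀ ^ 2 * s with hlam
  have hlam0 : 0 ≤ lam := by positivity
  set D := hubbardBonds G with hD
  set CC := connectedCellSets Bond.verts D with hCC
  set f : Finset (Bond Λ) → ℝ := fun X => ‖bondWeightC β U μ c X‖ * Real.exp (2 * (cellSupp Bond.verts X).card) with hf
  have hf0 : ∀ X, 0 ≤ f X := fun X => by positivity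
  -- Step a: bound by a sum over connected bond sets through `x`
  set Sx := CC.filter fun X => x ∈ cellSupp Bond.verts X with hSx
  have stepA : ∑ A ∈ 𝒜, ‖siteActivityC D β U μ c A‖ * Real.exp (2 * A.card) ≤ ∑ X ∈ Sx, f X := by
    have h1 : ∀ A ∈ 𝒜, ‖siteActivityC D β U μ c A‖ * Real.exp (2 * A.card) ≤
        ∑ X ∈ CC.filter (fun X => cellSupp Bond.verts X = A), f X := by
      intro A _
      rw [siteActivityC_apply, ← hCC]
      refine (mul_le_mul_of_nonneg_right (norm_sum_le _ _) (Real.exp_nonneg _)).trans ?_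
      rw [Finset.sum_mul]
      refine Finset.sum_le_sum fun X hX => le_of_eq ?_
      simp only [hf]
      rw [(Finset.mem_filter.1 hX).2]
    refine (Finset.sum_le_sum h1).trans ?_
    rw [← Finset.sum_biUnion]
    · refine Finset.sum_le_sum_of_subset_of_nonneg ?_ fun X _ _ => hf0 X
      intro X hX
      obtain ⟨A, hA, hXA⟩ := Finset.mem_biUnion.1 hX
      obtain ⟨hXCC, hXsupp⟩ := Finset.mem_filter.1 hXA
      exact Finset.mem_filter.2 ⟨hXCC, hXsupp ▸ h𝒜 A hA⟩
    · intro A hA B hB hAB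
      refine Finset.disjoint_left.2 fun X hXA hXB => hAB ?_
      rw [← (Finset.mem_filter.1 hXA).2, ← (Finset.mem_filter.1 hXB).2]
  -- Step b: each term is at most `λ^{|X|}`
  have stepB : ∀ X ∈ Sx, f X ≤ lam ^ X.card := by
    intro X _
    have hb := norm_bondWeightC_le hz hs0 hs1 hc X
    have hs := card_cellSupp_le X
    set k := X.card
    set m := (cellSupp Bond.verts X).card
    have hr0 := siteRatio_nonneg β U μ
    calc f X ≤ (Real.exp 2 * s) ^ k * siteRatio β U μ ^ m * Real.exp (2 * m) :=
          mul_le_mul_of_nonneg_right hb (Real.exp_nonneg _)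
      _ ≤ (Real.exp 2 * s) ^ k * r₀ ^ m * Real.exp (2 * m) := by
          gcongr
      _ = (Real.exp 2 * s) ^ k * (r₀ * Real.exp 2) ^ m := by
          rw [show (2 : ℝ) * m = (m : ℝ) * 2 by ring, Real.exp_nat_mul]; ring
      _ ≤ (Real.exp 2 * s) ^ k * (r₀ * Real.exp 2) ^ (2 * k) := by
          refine mul_le_mul_of_nonneg_left (pow_le_pow_right₀ ?_ hs) (by positivity)
          have : (1 : ℝ) ≤ Real.exp 2 := Real.one_le_exp two_pos.le
          nlinarith
      _ = lam ^ k := by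
          rw [hlam, pow_mul, ← mul_pow]
          congr 1
          have h6 : Real.exp 6 = Real.exp 2 ^ 3 := by
            rw [← Real.exp_nat_mul]; norm_num
          rw [h6]; ring
  -- Step c: cover `Sx` by the families through the bonds at `x`
  set Bx := D.filter fun b => x ∈ Bond.verts b with hBx
  have hcover : Sx ⊆ Bx.biUnion fun b₀ => CC.filter fun X => b₀ ∈ X := by
    intro X hX
    obtain ⟨hXCC, hx⟩ := Finset.mem_filter.1 hX
    obtain ⟨b₀, hb₀X, hxb₀⟩ := mem_cellSupp.1 hx
    have hb₀D : b₀ ∈ D := (mem_connectedCellSets.1 hXCC).1 hb₀X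
    exact Finset.mem_biUnion.2 ⟨b₀, Finset.mem_filter.2 ⟨hb₀D, hxb₀⟩, Finset.mem_filter.2 ⟨hXCC, hb₀X⟩⟩
  have stepC : ∑ X ∈ Sx, lam ^ X.card ≤ ∑ b₀ ∈ Bx, ∑ X ∈ CC.filter (fun X => b₀ ∈ X), lam ^ X.card :=
    (Finset.sum_le_sum_of_subset_of_nonneg hcover fun X _ _ => pow_nonneg hlam0 _).trans
      (sum_biUnion_le_sum_of_nonneg Bx _ _ fun X => pow_nonneg hlam0 _)
  -- Step d/e: entropy bound and the number of bonds at `x`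
  have stepD : ∀ b₀ ∈ Bx, ∑ X ∈ CC.filter (fun X => b₀ ∈ X), lam ^ X.card ≤ 2 * lam :=
    fun b₀ _ => sum_pow_card_connectedCellSets_le hΔ hlam0 hsmall b₀
  have stepE : (Bx.card : ℝ) ≤ 4 * Δ := by exact_mod_cast card_hubbardBonds_mem_verts_le hΔ x
  calc ∑ A ∈ 𝒜, ‖siteActivityC D β U μ c A‖ * Real.exp (2 * A.card)
      ≤ ∑ X ∈ Sx, f X := stepA
    _ ≤ ∑ X ∈ Sx, lam ^ X.card := Finset.sum_le_sum stepB
    _ ≤ ∑ b₀ ∈ Bx, ∑ X ∈ CC.filter (fun X => b₀ ∈ X), lam ^ X.card := stepC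
    _ ≤ ∑ _b₀ ∈ Bx, 2 * lam := Finset.sum_le_sum stepD
    _ = Bx.card * (2 * lam) := by rw [Finset.sum_const, nsmul_eq_mul]
    _ ≤ 4 * Δ * (2 * lam) := mul_le_mul_of_nonneg_right stepE (by positivity)
    _ = 8 * Δ * lam := by ring

end Smallness

end

end Summit.HubbardSuperconductivity.HubbardLadder.Bounds
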